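import Summits.ResolutionOfSingularities.ResolutionOfSingularities.Theorems.EquisingularLiftEquisingularLiftNatTowerRoundTwoDefs
import HarnessLib

/-!
# Route `EquisingularLift`, crux EL♮ (stmt-ResolutionOfSingularities-20038) / EL♮(3) (stmt-…-20148) — rungs TOWER / NOSE-TOWER, revision ₄:
# ALL ROUNDS ALONG SECTIONS (res-L1-w45b-stub-4's FINDING + PROPOSAL (α), 2026-08-27T20:22:51Z: the «doubled shadow» countermodel — a cone-witnessed
# centre that is a degree-2 multisection is admitted by `TowerRound₂` but its new exceptional surface is disconnected, so no ruled-root datum exists)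
# — append-only successor of …NatTowerRoundTwoDefs (p562650)

res-L1-w45b-lead-2 g2 (lead, text owner). OURS; planning vocabulary of the crux chain, not a statement of any manuscript; AI-written, weaker than
expert review. `TowerRound₃` := `TowerRound₂` with `DirStepSec F₉ F₁₀ υ' Z₉ hZ₉ G γ Z hZ` HOISTED in front of the admission disjunction (so the
cone-witnessed disjunct, too, runs along a SECTION of the exceptional surface over the carrier); `ReachTower₄` / `ReachNoseTower₄` use it. LOSES NO
INTENDED CHAIN (stub-4): a cone-witnessed centre over an irreducible carrier with a unibranch-smooth cone is generically of degree 1, hence a section.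
Forgetful lemmas `towerRound₃_of_towerRound₂`, `reachTower₃_of_reachTower₄` (₄ ⊆ ₃ ⊆ ₂ ⊆ ₁: every lower-revision file is reused) and
`reachTower₄_of_reachDirZero₁` (DIR₀₁ ⊆ TOWER₄) kernel-checked. Registered stub NAMES kept.
-/

set_option linter.dupNamespace false

noncomputable section

open CategoryTheory AlgebraicGeometry TopologicalSpace
open Literature.AlgebraicGeometry.Resolution (IsBlowup stalkIdeal)

namespace Summit.ResolutionOfSingularities.ResolutionOfSingularities.Cruxes.EquisingularLiftNat.Sections

/-- **TOWER / (round), revision ₃ — all rounds along sections**: `TowerRound₂` with `DirStepSec` hoisted in front of the (Čech ∨ cone) disjunction.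
Downstairs only. -/
def TowerRound₃ (F₉ F₁₀ : Scheme.{0}) (υ' : F₁₀ ⟶ F₉) (Z₉ : Set F₉) (hZ₉ : IsClosed Z₉)
    (R₁ : ∀ G : Scheme.{0}, (G ⟶ F₁₀) → Set G → Set G → Set G → Prop) : Prop :=
  ∀ (G G' : Scheme.{0}) (γ : G ⟶ F₁₀) (T E K : Set G) (hE : IsClosed E) (Z : Set G) (hZ : IsClosed Z) (υ₂ : G' ⟶ G) (K' : Set G'),
    R₁ G γ T E K →
    Z ⊆ E ∩ T → Z.Nonempty →
    TowerFull F₉ F₁₀ υ' Z₉ hZ₉ G γ Z hZ →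
    DirStepSec F₉ F₁₀ υ' Z₉ hZ₉ G γ Z hZ →
    ((RationalCarrier (redSub F₉ Z₉ hZ₉) ∧
        (∀ x : redSub G Z hZ, IsRegularLocalRing (G.presheaf.stalk (redSubι G Z hZ x))) ∧
        (∀ (i : redSub G Z hZ ⟶ redSub G E hE), i ≫ redSubι G E hE = redSubι G Z hZ →
          ∀ x : redSub G Z hZ, IsRegularLocalRing ((redSub G E hE).presheaf.stalk (i x))) ∧
        DirStepUnobs G E hE Z hZ) ∨
      ConeWitness G E hE K Z hZ) →
    IsBlowup υ₂ (Scheme.IdealSheafData.vanishingIdeal (⟨Z, hZ⟩ : Closeds G)) →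
    (K' = ∅ ∨ ((ConeWitness G E hE K Z hZ ∨ closure (Z \ closure K) = Z) ∧ K' = closure (υ₂ ⁻¹' (K \ Z)))) →
    R₁ G' (υ₂ ≫ γ) (closure (υ₂ ⁻¹' (T \ Z))) (υ₂ ⁻¹' Z) K' ∧
      R₁ G' (υ₂ ≫ γ) (closure (υ₂ ⁻¹' (T \ Z))) (closure (υ₂ ⁻¹' (E \ Z))) K'

/-- **ReachTower₄** — `ReachTower₃` with `TowerRound₃`. Downstairs only; K5′'s `Reach` slot. -/
def ReachTower₄ (F₁ F₂ : Scheme.{0}) (υ : F₂ ⟶ F₁) (x : F₁) (T₂ : Set F₂) (F' : Scheme.{0}) (β : F' ⟶ F₂) (T' : Set F') : Prop :=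
  ∃ (W : Set F₁) (K₂ : Set F₂) (F₉ : Scheme.{0}) (β₉ : F₉ ⟶ F₂) (T₉ Z₉ K₉ : Set F₉) (b₉ : Bool) (hZ₉ : IsClosed Z₉)
    (F₁₀ : Scheme.{0}) (υ' : F₁₀ ⟶ F₉) (γ' : F' ⟶ F₁₀) (E' K' : Set F'),
    x ∈ W ∧ ¬ (υ ⁻¹' {x} ⊆ closure (υ ⁻¹' (W \ {x}))) ∧
    (∃ U : F₁.affineOpens, x ∈ (U : F₁.Opens) ∧
      ((Scheme.IdealSheafData.vanishingIdeal (⟨closure W, isClosed_closure⟩ : Closeds F₁)).ideal U).IsPrincipal) ∧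
    υ ⁻¹' {x} ∩ closure (υ ⁻¹' (W \ {x})) ⊆ T₂ ∧
    (K₂ = ∅ ∨ (ConeForm F₁ x W ∧ K₂ = closure (υ ⁻¹' (W \ {x})))) ∧
    InCarrierReachK F₂ T₂ (υ ⁻¹' {x} ∩ closure (υ ⁻¹' (W \ {x}))) K₂ F₉ β₉ T₉ Z₉ K₉ b₉ ∧
    Z₉ ⊆ T₉ ∧ ¬ (T₉ ⊆ Z₉) ∧ Z₉.Infinite ∧
    Set.Finite {z : redSub F₉ Z₉ hZ₉ | ¬ IsRegularLocalRing ((redSub F₉ Z₉ hZ₉).presheaf.stalk z)} ∧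
    IsBlowup υ' (Scheme.IdealSheafData.vanishingIdeal (⟨Z₉, hZ₉⟩ : Closeds F₉)) ∧
    (∀ R₁ : (∀ G : Scheme.{0}, (G ⟶ F₁₀) → Set G → Set G → Set G → Prop),
      R₁ F₁₀ (𝟙 F₁₀) (closure (υ' ⁻¹' (T₉ \ Z₉))) (υ' ⁻¹' Z₉) (closure (υ' ⁻¹' (K₉ \ Z₉))) →
      TowerPtReg₂ F₉ F₁₀ υ' R₁ → TowerPtRam₂ F₉ F₁₀ υ' R₁ → TowerRound₃ F₉ F₁₀ υ' Z₉ hZ₉ R₁ → R₁ F' γ' T' E' K') ∧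
    β = (γ' ≫ υ') ≫ β₉

/-- **NOSE-TOWER, revision ₄** — `ReachNoseTower₃` with `TowerRound₃`. Downstairs only. -/
def ReachNoseTower₄ (k : Type) [Field k] (n : ℕ) (H : Scheme.{0})
    (ι : H ⟶ (Literature.AlgebraicGeometry.Motives.projectiveSpace n k).left) : Prop :=
  ∃ (Z : Set (Literature.AlgebraicGeometry.Motives.projectiveSpace n k).left) (hZ : IsClosed Z),
    IsLiftableNoseClass₂ k n Z ∧ Z ⊆ Set.range ι ∧ ¬ (Set.range ι ⊆ Z) ∧ Z.Infinite ∧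
    Nonempty (redSub (Literature.AlgebraicGeometry.Motives.projectiveSpace n k).left Z hZ ≅
      (Literature.AlgebraicGeometry.Motives.projectiveSpace 1 k).left) ∧
    ∃ (F₂ : Scheme.{0}) (υ : F₂ ⟶ (Literature.AlgebraicGeometry.Motives.projectiveSpace n k).left),
      IsBlowup υ (Scheme.IdealSheafData.vanishingIdeal
        (⟨Z, hZ⟩ : Closeds (Literature.AlgebraicGeometry.Motives.projectiveSpace n k).left)) ∧
      ∃ (F' : Scheme.{0}) (γ' : F' ⟶ F₂) (T' E' K' : Set F'),
        (∀ R₁ : (∀ G : Scheme.{0}, (G ⟶ F₂) → Set G → Set G → Set G → Prop),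
          R₁ F₂ (𝟙 F₂) (closure (υ ⁻¹' (Set.range ι \ Z))) (υ ⁻¹' Z) ∅ →
          TowerPtReg₂ (Literature.AlgebraicGeometry.Motives.projectiveSpace n k).left F₂ υ R₁ →
          TowerPtRam₂ (Literature.AlgebraicGeometry.Motives.projectiveSpace n k).left F₂ υ R₁ →
          TowerRound₃ (Literature.AlgebraicGeometry.Motives.projectiveSpace n k).left F₂ υ Z hZ R₁ →
          R₁ F' γ' T' E' K') ∧
        Literature.AlgebraicGeometry.Resolution.Scheme.IsRegular (redSub F' (closure T') isClosed_closure)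

/-- Closure under `₂`-rounds implies closure under `₃`-rounds (the `₃` rounds are among the `₂` rounds). [OURS · pure logic] -/
theorem towerRound₃_of_towerRound₂ (F₉ F₁₀ : Scheme.{0}) (υ' : F₁₀ ⟶ F₉) (Z₉ : Set F₉) (hZ₉ : IsClosed Z₉)
    (R₁ : ∀ G : Scheme.{0}, (G ⟶ F₁₀) → Set G → Set G → Set G → Prop) (h : TowerRound₂ F₉ F₁₀ υ' Z₉ hZ₉ R₁) :
    TowerRound₃ F₉ F₁₀ υ' Z₉ hZ₉ R₁ := by
  intro G G' γ T E K hE Z hZ υ₂ K' hR hZET hne hfull hsec hadm hυ₂ hK'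
  refine h G G' γ T E K hE Z hZ υ₂ K' hR hZET hne hfull ?_ hυ₂ hK'
  rcases hadm with ⟨hrat, hG, hEreg, hunobs⟩ | hcone
  · exact Or.inl ⟨hsec, hrat, hG, hEreg, hunobs⟩
  · exact Or.inr hcone

/-- **TOWER₄ ⊆ TOWER₃** (forgetful). [OURS · pure logic] -/
theorem reachTower₃_of_reachTower₄ (F₁ F₂ : Scheme.{0}) (υ : F₂ ⟶ F₁) (x : F₁) (T₂ : Set F₂) (F' : Scheme.{0}) (β : F' ⟶ F₂)
    (T' : Set F') (h : ReachTower₄ F₁ F₂ υ x T₂ F' β T') : ReachTower₃ F₁ F₂ υ x T₂ F' β T' := by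
  obtain ⟨W, K₂, F₉, β₉, T₉, Z₉, K₉, b₉, hZ₉, F₁₀, υ', γ', E', K', h1, h2, h3, h4, h5, h6, h7, h8, h9, h10, h11, hcl, hβ⟩ := h
  exact ⟨W, K₂, F₉, β₉, T₉, Z₉, K₉, b₉, hZ₉, F₁₀, υ', γ', E', K', h1, h2, h3, h4, h5, h6, h7, h8, h9, h10, h11,
    fun R₁ hseed hreg hram hround => hcl R₁ hseed hreg hram (towerRound₃_of_towerRound₂ F₉ F₁₀ υ' Z₉ hZ₉ R₁ hround), hβ⟩

/-- **DIR₀₁ ⊆ TOWER₄**: direction rounds are section rounds. [OURS · pure logic] -/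
theorem reachTower₄_of_reachDirZero₁ (F₁ F₂ : Scheme.{0}) (υ : F₂ ⟶ F₁) (x : F₁) (T₂ : Set F₂) (F' : Scheme.{0}) (β : F' ⟶ F₂)
    (T' : Set F') (h : ReachDirZero₁ F₁ F₂ υ x T₂ F' β T') : ReachTower₄ F₁ F₂ υ x T₂ F' β T' := by
  obtain ⟨W, F₉, β₉, T₉, Z₉, b₉, hZ₉, F₁₀, υ', γ', E', ⟨hxW, hnot, hWpr, hZT, hinner, hZ₉T₉, hT₉Z₉, hfin, hυ'⟩, hrat, hinf, hdir, hβ⟩ := h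
  obtain ⟨K₉, hK₉⟩ := exists_inCarrierReachK F₂ T₂ (υ ⁻¹' {x} ∩ closure (υ ⁻¹' (W \ {x}))) ∅ F₉ β₉ T₉ Z₉ b₉ hinner
  let ReachT : ∀ G : Scheme.{0}, (G ⟶ F₁₀) → Set G → Set G → Set G → Prop := fun G γ T E K =>
    ∀ R₁ : (∀ G : Scheme.{0}, (G ⟶ F₁₀) → Set G → Set G → Set G → Prop),
      R₁ F₁₀ (𝟙 F₁₀) (closure (υ' ⁻¹' (T₉ \ Z₉))) (υ' ⁻¹' Z₉) (closure (υ' ⁻¹' (K₉ \ Z₉))) →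
      TowerPtReg₂ F₉ F₁₀ υ' R₁ → TowerPtRam₂ F₉ F₁₀ υ' R₁ → TowerRound₃ F₉ F₁₀ υ' Z₉ hZ₉ R₁ → R₁ G γ T E K
  have hreach : ∃ K' : Set F', ReachT F' γ' T' E' K' := by
    refine hdir (fun G γ T E => ∃ K : Set G, ReachT G γ T E K) ⟨closure (υ' ⁻¹' (K₉ \ Z₉)), fun R₁ hseed _ _ _ => hseed⟩ ?_
    intro G G'' γ T E hE Γ hΓ υ₂ ⟨K, hK⟩ hΓET hΓirr hsec hGreg hEreg hunobs hυ₂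
    have hstep : ∀ R₁ : (∀ G : Scheme.{0}, (G ⟶ F₁₀) → Set G → Set G → Set G → Prop),
        R₁ F₁₀ (𝟙 F₁₀) (closure (υ' ⁻¹' (T₉ \ Z₉))) (υ' ⁻¹' Z₉) (closure (υ' ⁻¹' (K₉ \ Z₉))) →
        TowerPtReg₂ F₉ F₁₀ υ' R₁ → TowerPtRam₂ F₉ F₁₀ υ' R₁ → TowerRound₃ F₉ F₁₀ υ' Z₉ hZ₉ R₁ →
        R₁ G'' (υ₂ ≫ γ) (closure (υ₂ ⁻¹' (T \ Γ))) (υ₂ ⁻¹' Γ) ∅ ∧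
          R₁ G'' (υ₂ ≫ γ) (closure (υ₂ ⁻¹' (T \ Γ))) (closure (υ₂ ⁻¹' (E \ Γ))) ∅ := by
      intro R₁ hseed hreg hram hround
      have hfull : TowerFull F₉ F₁₀ υ' Z₉ hZ₉ G γ Γ hΓ := by
        obtain ⟨δ, hδ, hiso⟩ := hsec
        exact ⟨δ, hδ, inferInstance, inferInstance, δ.surjective⟩
      exact hround G G'' γ T E K hE Γ hΓ υ₂ ∅ (hK R₁ hseed hreg hram hround) hΓET hΓirr.nonempty hfull hsec
        (Or.inl ⟨hrat, hGreg, hEreg, hunobs⟩) hυ₂ (Or.inl rfl)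
    exact ⟨⟨∅, fun R₁ hseed hreg hram hround => (hstep R₁ hseed hreg hram hround).1⟩,
      ⟨∅, fun R₁ hseed hreg hram hround => (hstep R₁ hseed hreg hram hround).2⟩⟩
  obtain ⟨K', hK'⟩ := hreach
  exact ⟨W, ∅, F₉, β₉, T₉, Z₉, K₉, b₉, hZ₉, F₁₀, υ', γ', E', K', hxW, hnot, hWpr, hZT, Or.inl rfl, hK₉, hZ₉T₉, hT₉Z₉, hinf, hfin, hυ',
    hK', hβ⟩

end Summit.ResolutionOfSingularities.ResolutionOfSingularities.Cruxes.EquisingularLiftNat.Sections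

end
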